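import Summits.BirchSwinnertonDyer.BirchSwinnertonDyer.Theorems.SignedBaseChangeAnticyclotomicEisensteinDivisibilityControlTorsionLocal
import Literature.NumberTheory.EllipticCurves.SupersingularInertiaNoFixedPointProofs
import Literature.NumberTheory.EllipticCurves.SerreInertiaImageBaseChangeProofs
import HarnessLib

/-!
# `stub_torsionSS` (crux `AnticyclotomicEisensteinDivisibility`, stmt-BirchSwinnertonDyer-20727, line
# `bdpline`) from three PRINTED one-variable / local shapes: `X_ac` `Λ`-torsion, Serre's Prop. 12 (c)
# at `v̄` (cyclic inertia image of order `p² − 1` on `E[p]`), and Castella's away-from-`p` discrepancy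

Width seat bsd-line-sbc-p1-w2 gen 2 (2026-08-28). Final link of the chain
`…ControlCoker` (p612958) → `…ControlTorsion` (p613583) → `…ControlTorsionLocal` (p617582): there the
two-variable stub `stub_torsionSS` (`Module.IsTorsion Λ₂ X_Gr(E/K̃_∞)`) was reduced to (a) `X_ac`
`Λ`-torsion, (V) the vanishing `E[p^∞]^{Gal(K̄/K̃_∞) ⊓ I_v̄} = 0`, and (b₁) the one-variable away-from-`p`
/archimedean discrepancy. The Literature file `SupersingularInertiaNoFixedPointProofs` (this seat) derives
(V) from the PRINTED shape of Serre, Invent. Math. 15 (1972), §1.11 Prop. 12 (c) for the local inertia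
group `I_v̄ ≤ Γ_K` — "l'image de `I` dans `GL(E_p)` est un groupe cyclique d'ordre `p² − 1`" — via the
prime-to-`p` transfer down the `ℤ_p²`-tower (`TwoVariableTowerPrimeToPImageProofs`) and the freeness of a
cyclic group of order `p² − 1` on `E[p]`. Hence:

* `xGr₂_isTorsion_of_isTorsion_XAc_of_serre_of_away` (general binders): `Module.IsTorsion Λ₂ X_Gr₂` ⟸
  (a) ∧ (S) `IsCyclic (ρ̄_{E,p}(I_v̄)) ∧ #ρ̄_{E,p}(I_v̄) = p² − 1` ∧ (b₁).
* `stub_torsionSS_of_isTorsion_XAc_of_serre_of_away`: the same with the telescope binders of the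
  registered stub (bdpline v8–v11) copied verbatim after the two unused named-fact antecedents — the
  reshape template `stub_torsionSS := … (stub_torsionAcSS) (stub_serreInertiaSS) (stub_awayDiscrepancySS)`,
  each right-hand stub a one-variable / local statement with a printed source: (a) BDP/CGLS/Kobayashi–Ota;
  (S) Serre 1972 Prop. 12 (c) at the degree-one supersingular place `v̄` of `K` (the tree proves it over
  `ℚ`: `isCyclic_and_card_inertia_map_of_dvd_frobeniusTrace`; the transport to `K_v̄ = ℚ_p` is a typer's
  task); (b₁) Castella 2018 §2.2 (`⊕_{w ∤ p} ℋ^ur_w`, zero on the Heegner leaf).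
Honest framing: (a), (S), (b₁) are hypotheses; nothing about BSD or the crux is asserted.

References: J.-P. Serre, Invent. Math. 15 (1972), §1.11 Prop. 12; C. Skinner, E. Urban, Invent. Math.
195 (2014), Prop. 3.2.8; F. Castella, Camb. J. Math. 6 (2018), Def. 2.2, §2.2; B. Gross (1991), §2.
-/

-- D-0017: single-problem summit, the namespace repeats the problem name by design.
set_option linter.dupNamespace false
set_option autoImplicit false

noncomputable section

open scoped Classical

open Literature.NumberTheory.EllipticCurves Literature.NumberTheory.EllipticCurves.Castella2018
  Literature.NumberTheory.EllipticCurves.GreenbergVatsal2000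

namespace Summit.BirchSwinnertonDyer.BirchSwinnertonDyer.Theorems.SignedBaseChangeAcDivControlTorsion

section General

variable {K : Type} [Field K] [NumberField K] (W : WeierstrassCurve K) [W.IsElliptic] (p : ℕ) [Fact p.Prime]
  (κ₁ κ₂ : ZpExtension K p) (vbar : IsDedekindDomain.HeightOneSpectrum (NumberField.RingOfIntegers K))
  (γ₁ γ₂ : Field.absoluteGaloisGroup K) [hγ : Fact (ZpExtension.IsTopGeneratorPair κ₁ κ₂ γ₁ γ₂)]
  [Fact (κ₂.IsTopGenerator γ₂)]

/-- **`X_Gr(E/K̃_∞)` is `Λ₂`-torsion from (a) `X_ac` `Λ`-torsion, (S) Serre's Prop. 12 (c) shape at `v̄`,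
(b₁) the one-variable away-from-`p` discrepancy** (`W` elliptic over a number field `K`, `E(K)[p] = 0`,
`κ₁` cyclotomic, generator pair, `p ∈ v̄`): (S) = `ρ̄_{E,p}(I_v̄)` cyclic of order `p² − 1` gives the
vanishing `E[p^∞]^{pairKer ⊓ I_v̄} = 0` (`InertiaFixedPoint.primary_eq_zero_of_forall_pairKer_inf_inertia_smul_eq`),
then `xGr₂_isTorsion_of_isTorsion_XAc_of_vanishing_of_away`. [cite: Serre1972, §1.11 Prop. 12 c)]
[cite: SkinnerUrban2014, Prop. 3.2.8 (p. 23)] [cite: Castella2018, §2.2 (arXiv:1704.06608 p. 7)] -/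
theorem xGr₂_isTorsion_of_isTorsion_XAc_of_serre_of_away (hκ₁ : κ₁.IsCyclotomic)
    (hvbar : ((p : ℕ) : NumberField.RingOfIntegers K) ∈ vbar.asIdeal)
    (hK : ∀ P : W.toAffine.Point, p • P = 0 → P = 0)
    (hS : IsCyclic ((GreenbergSelmer.inertia vbar).map (W.galoisRepTorsion (p : ℤ))) ∧
      Nat.card ((GreenbergSelmer.inertia vbar).map (W.galoisRepTorsion (p : ℤ))) = p ^ 2 - 1)
    (hac : Module.IsTorsion (IwasawaAlgebra p) (AcSelmer.XAc W p κ₂ vbar ∅ γ₂))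
    (hQ₁ : ∀ x : W.XGr₂ p κ₁ κ₂ vbar γ₁ γ₂,
      (∀ s : AcSelmer.selmerAc W p κ₂ vbar ∅, x (W.selmerAcToUnrSelmer₂ p κ₁ κ₂ vbar s) = 0) →
        ∃ g : IwasawaAlgebra p, g ≠ 0 ∧ ∀ (a : W.subgroupH1 p κ₂.kerSubgroup)
          (ha : a ∈ datumStrictSelmer κ₂.kerSubgroup (W.geomPrimaryTorsion p) p
            (AcSelmer.bdpData (W.geomPrimaryTorsion p) p vbar) ∅),
          ((PowerSeries.C g : IwasawaAlgebra₂ p) • x)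
            ⟨_, resOfLe_mem_unrSelmer₂_of_mem_datumStrictSelmer W p κ₁ κ₂ vbar hκ₁ hvbar
              (fun _ hm ↦ InertiaFixedPoint.primary_eq_zero_of_forall_pairKer_inf_inertia_smul_eq
                W κ₁ κ₂ vbar hS.1 hS.2 hm) ha⟩ = 0) :
    Module.IsTorsion (IwasawaAlgebra₂ p) (W.XGr₂ p κ₁ κ₂ vbar γ₁ γ₂) :=
  xGr₂_isTorsion_of_isTorsion_XAc_of_vanishing_of_away W p κ₁ κ₂ vbar γ₁ γ₂ hκ₁ hvbar hK
    (fun _ hm ↦ InertiaFixedPoint.primary_eq_zero_of_forall_pairKer_inf_inertia_smul_eq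
      W κ₁ κ₂ vbar hS.1 hS.2 hm) hac hQ₁

end General

/-- **`stub_torsionSS` ⟸ (a) `X_ac` `Λ`-torsion + (S) Serre 1972 Prop. 12 (c) at `v̄` + (b₁) away-from-`p`
discrepancy**, with the telescope binders of the registered stub of line `bdpline` copied verbatim after
the two unused named-fact antecedents (`κ₁.IsCyclotomic`, `p ∈ v̄` are binders; `E(K)[p] = 0` from `Surj`
and `K` imaginary quadratic, `torsionBy_eq_bot_of_isImaginaryQuadratic`). A reshape template: three
one-variable / local stubs, each a printed statement, in place of the two-variable one.
[cite: Serre1972, §1.11 Prop. 12 c)] [cite: SkinnerUrban2014, Prop. 3.2.8 (p. 23)]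
[cite: Castella2018, Def. 2.2 and §2.2 (arXiv:1704.06608 pp. 5, 7)] [cite: GrossLMS1991, §2 (after (2.2))] -/
theorem stub_torsionSS_of_isTorsion_XAc_of_serre_of_away :
    ∀ (W : WeierstrassCurve ℚ) [W.IsElliptic] [W.IsGloballyMinimal] (p : ℕ) [Fact p.Prime], 5 ≤ p → W.HasGoodReductionAtPrime p → W.frobeniusTrace p = 0 → Literature.NumberTheory.EllipticCurves.Rank1Residual.Surj W p → ∀ (K : Type) [Field K] [NumberField K] (ι : PadicAlgCl p ≃+* ℂ) (v vbar : IsDedekindDomain.HeightOneSpectrum (NumberField.RingOfIntegers K)) (κ₁ κ₂ : Literature.NumberTheory.EllipticCurves.ZpExtension K p) (γ₁ γ₂ : Field.absoluteGaloisGroup K) [Fact (Literature.NumberTheory.EllipticCurves.ZpExtension.IsTopGeneratorPair κ₁ κ₂ γ₁ γ₂)] [NeZero (NumberField.discr K).natAbs] (N : ℕ) [NeZero N] (f : CuspForm (CongruenceSubgroup.Gamma0 N) 2), Literature.NumberTheory.EllipticCurves.ModularForms.IsNewformOf W f → (N : ℤ) = W.conductorNorm ℤ → Literature.NumberTheory.EllipticCurves.IsImaginaryQuadratic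 K → ((Ideal.span {(p : ℤ)}).primesOver (NumberField.RingOfIntegers K)).ncard = 2 → ((p : ℕ) : NumberField.RingOfIntegers K) ∈ v.asIdeal → ((p : ℕ) : NumberField.RingOfIntegers K) ∈ vbar.asIdeal → vbar ≠ v → (∀ (w : NumberField.InfinitePlace K) (k : NumberField.RingOfIntegers K), k ∈ v.asIdeal ↔ ‖ι.symm (w.embedding (k : K))‖ < 1) → IsCoprime (N : ℤ) (NumberField.discr K) → (∀ ℓ : ℕ, ℓ.Prime → ℓ ∣ N → ((Ideal.span {(ℓ : ℤ)}).primesOver (NumberField.RingOfIntegers K)).ncard = 2) → Odd (NumberField.discr K) → NumberField.discr K ≠ -3 → ∀ (hκ₁ : κ₁.IsCyclotomic), κ₂.IsAnticyclotomic →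
      -- (a) one-variable anticyclotomic torsion (print currency)
      (haveI : Fact (κ₂.IsTopGenerator γ₂) := ⟨Literature.NumberTheory.EllipticCurves.YanZhu2026.isTopGenerator_of_pair (κ₁ := κ₁) (γ₁ := γ₁)⟩; Module.IsTorsion (Literature.NumberTheory.EllipticCurves.IwasawaAlgebra p) (Literature.NumberTheory.EllipticCurves.Castella2018.AcSelmer.XAc (W.baseChange K) p κ₂ vbar ∅ γ₂)) →
      -- (S) Serre 1972 Prop. 12 (c) at `v̄`: the local inertia group acts on `E[p]` through a cyclic group of order `p² − 1`
      ∀ (hS : IsCyclic ((Literature.NumberTheory.EllipticCurves.GreenbergSelmer.inertia vbar).map ((W.baseChange K).galoisRepTorsion (p : ℤ))) ∧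
          Nat.card ((Literature.NumberTheory.EllipticCurves.GreenbergSelmer.inertia vbar).map ((W.baseChange K).galoisRepTorsion (p : ℤ))) = p ^ 2 - 1),
      -- (b₁) the one-variable away-from-`p` / archimedean discrepancy is `Λ`-cotorsion (Pontryagin-dual form)
      (∀ (hvbar : ((p : ℕ) : NumberField.RingOfIntegers K) ∈ vbar.asIdeal) (x : (W.baseChange K).XGr₂ p κ₁ κ₂ vbar γ₁ γ₂),
        (∀ s : Literature.NumberTheory.EllipticCurves.Castella2018.AcSelmer.selmerAc (W.baseChange K) p κ₂ vbar ∅,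
          x ((W.baseChange K).selmerAcToUnrSelmer₂ p κ₁ κ₂ vbar s) = 0) →
        ∃ g : Literature.NumberTheory.EllipticCurves.IwasawaAlgebra p, g ≠ 0 ∧
          ∀ (a : (W.baseChange K).subgroupH1 p κ₂.kerSubgroup)
            (ha : a ∈ Literature.NumberTheory.EllipticCurves.GreenbergVatsal2000.datumStrictSelmer κ₂.kerSubgroup ((W.baseChange K).geomPrimaryTorsion p) p
              (Literature.NumberTheory.EllipticCurves.Castella2018.AcSelmer.bdpData ((W.baseChange K).geomPrimaryTorsion p) p vbar) ∅),
            ((PowerSeries.C g : Literature.NumberTheory.EllipticCurves.IwasawaAlgebra₂ p) • x)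
              ⟨_, resOfLe_mem_unrSelmer₂_of_mem_datumStrictSelmer (W.baseChange K) p κ₁ κ₂ vbar hκ₁ hvbar
                (fun _ hm ↦ by
                  haveI : (W.baseChange K).IsElliptic := by rw [WeierstrassCurve.baseChange]; infer_instance
                  exact Literature.NumberTheory.EllipticCurves.InertiaFixedPoint.primary_eq_zero_of_forall_pairKer_inf_inertia_smul_eq
                    (W.baseChange K) κ₁ κ₂ vbar hS.1 hS.2 hm) ha⟩ = 0) →
      Module.IsTorsion (Literature.NumberTheory.EllipticCurves.IwasawaAlgebra₂ p) ((W.baseChange K).XGr₂ p κ₁ κ₂ vbar γ₁ γ₂) := by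
  intro W _ _ p _ hp _ _ hs K _ _ ι v vbar κ₁ κ₂ γ₁ γ₂ _ _ N _ f _ _ hK _ _ hvbar _ _ _ _ _ _ hκ₁ _ hac hS hQ₁
  haveI hγ₂ : Fact (κ₂.IsTopGenerator γ₂) :=
    ⟨Literature.NumberTheory.EllipticCurves.YanZhu2026.isTopGenerator_of_pair (κ₁ := κ₁) (γ₁ := γ₁)⟩
  -- `E(K)[p] = 0` from `Surj`, `p ≠ 2`, `K` imaginary quadratic
  have hp2 : p ≠ 2 := by omega
  have htor := torsionBy_eq_bot_of_isImaginaryQuadratic W K hK (Fact.out) hp2 hs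
  have hKp : ∀ P : (W.baseChange K).toAffine.Point, p • P = 0 → P = 0 := fun P hP => by
    have hmem : P ∈ AddSubgroup.torsionBy (W.baseChange K).toAffine.Point (p : ℤ) :=
      AddSubgroup.torsionBy.nsmul_iff.mpr hP
    rw [htor] at hmem
    exact AddSubgroup.mem_bot.mp hmem
  haveI hE : (W.baseChange K).IsElliptic := by rw [WeierstrassCurve.baseChange]; infer_instance
  exact xGr₂_isTorsion_of_isTorsion_XAc_of_serre_of_away (W.baseChange K) p κ₁ κ₂ vbar γ₁ γ₂ hκ₁
    hvbar hKp hS hac (hQ₁ hvbar)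

/-- **`stub_torsionSS` ⟸ (a) `X_ac` `Λ`-torsion + (b₁) the one-variable away-from-`p` discrepancy** —
(S) DISCHARGED: under the stub's telescope (good supersingular `p ≥ 5`, `K` imaginary quadratic,
`p = v v̄` split) Serre's Prop. 12 (c) for `I_v̄` on `E_K[p]` is the tree theorem
`InertiaFixedPoint.isCyclic_and_card_inertia_map_baseChange` (transport of the `ℚ`-statement), so the
two-variable stub reduces to TWO one-variable statements over `K_∞⁻`: (a) Castella's `X_ac` is
`Λ`-torsion and (b₁) the unramified-vs-trivial discrepancy away from `p` (and at `∞`) is `Λ`-cotorsion.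
Telescope binders copied verbatim after the two unused named-fact antecedents.
[cite: Serre1972, §1.11 Prop. 12 c)] [cite: SkinnerUrban2014, Prop. 3.2.8 (p. 23)]
[cite: Castella2018, Def. 2.2 and §2.2 (arXiv:1704.06608 pp. 5, 7)] [cite: GrossLMS1991, §2 (after (2.2))] -/
theorem stub_torsionSS_of_isTorsion_XAc_of_away :
    ∀ (W : WeierstrassCurve ℚ) [W.IsElliptic] [W.IsGloballyMinimal] (p : ℕ) [Fact p.Prime] (hp5 : 5 ≤ p) (hgood : W.HasGoodReductionAtPrime p) (ha0 : W.frobeniusTrace p = 0), Literature.NumberTheory.EllipticCurves.Rank1Residual.Surj W p → ∀ (K : Type) [Field K] [NumberField K] (ι : PadicAlgCl p ≃+* ℂ) (v vbar : IsDedekindDomain.HeightOneSpectrum (NumberField.RingOfIntegers K)) (κ₁ κ₂ : Literature.NumberTheory.EllipticCurves.ZpExtension K p) (γ₁ γ₂ : Field.absoluteGaloisGroup K) [Fact (Literature.NumberTheory.EllipticCurves.ZpExtension.IsTopGeneratorPair κ₁ κ₂ γ₁ γ₂)] [NeZero (NumberField.discr K).natAbs] (N : ℕ) [NeZero N] (f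 : CuspForm (CongruenceSubgroup.Gamma0 N) 2), Literature.NumberTheory.EllipticCurves.ModularForms.IsNewformOf W f → (N : ℤ) = W.conductorNorm ℤ → ∀ (hK : Literature.NumberTheory.EllipticCurves.IsImaginaryQuadratic K), ((Ideal.span {(p : ℤ)}).primesOver (NumberField.RingOfIntegers K)).ncard = 2 → ∀ (hpv : ((p : ℕ) : NumberField.RingOfIntegers K) ∈ v.asIdeal) (hvbar : ((p : ℕ) : NumberField.RingOfIntegers K) ∈ vbar.asIdeal) (hne : vbar ≠ v), (∀ (w : NumberField.InfinitePlace K) (k : NumberField.RingOfIntegers K), k ∈ v.asIdeal ↔ ‖ι.symm (w.embedding (k : K))‖ < 1) → IsCoprime (N : ℤ) (NumberField.discr K) → (∀ ℓ : ℕ, ℓ.Prime → ℓ ∣ N → ((Ideal.span {(ℓ : ℤ)}).primesOver (NumberField.RingOfIntegers K)).ncard = 2) → Odd (NumberField.discr K) → NumberField.discr K ≠ -3 → ∀ (hκ₁ : κ₁.IsCyclotomic), κ₂.IsAnticyclotomic →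
      -- (a) one-variable anticyclotomic torsion (print currency)
      (haveI : Fact (κ₂.IsTopGenerator γ₂) := ⟨Literature.NumberTheory.EllipticCurves.YanZhu2026.isTopGenerator_of_pair (κ₁ := κ₁) (γ₁ := γ₁)⟩; Module.IsTorsion (Literature.NumberTheory.EllipticCurves.IwasawaAlgebra p) (Literature.NumberTheory.EllipticCurves.Castella2018.AcSelmer.XAc (W.baseChange K) p κ₂ vbar ∅ γ₂)) →
      -- (b₁) the one-variable away-from-`p` / archimedean discrepancy is `Λ`-cotorsion (Pontryagin-dual form)
      (∀ (x : (W.baseChange K).XGr₂ p κ₁ κ₂ vbar γ₁ γ₂),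
        (∀ s : Literature.NumberTheory.EllipticCurves.Castella2018.AcSelmer.selmerAc (W.baseChange K) p κ₂ vbar ∅,
          x ((W.baseChange K).selmerAcToUnrSelmer₂ p κ₁ κ₂ vbar s) = 0) →
        ∃ g : Literature.NumberTheory.EllipticCurves.IwasawaAlgebra p, g ≠ 0 ∧
          ∀ (a : (W.baseChange K).subgroupH1 p κ₂.kerSubgroup)
            (ha : a ∈ Literature.NumberTheory.EllipticCurves.GreenbergVatsal2000.datumStrictSelmer κ₂.kerSubgroup ((W.baseChange K).geomPrimaryTorsion p) p
              (Literature.NumberTheory.EllipticCurves.Castella2018.AcSelmer.bdpData ((W.baseChange K).geomPrimaryTorsion p) p vbar) ∅),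
            ((PowerSeries.C g : Literature.NumberTheory.EllipticCurves.IwasawaAlgebra₂ p) • x)
              ⟨_, resOfLe_mem_unrSelmer₂_of_mem_datumStrictSelmer (W.baseChange K) p κ₁ κ₂ vbar hκ₁ hvbar
                (fun _ hm ↦ by
                  haveI : (W.baseChange K).IsElliptic := by rw [WeierstrassCurve.baseChange]; infer_instance
                  have hS := Literature.NumberTheory.EllipticCurves.InertiaFixedPoint.isCyclic_and_card_inertia_map_baseChange
                    (K := K) W (ne_of_gt (lt_of_lt_of_le (by norm_num) hp5)) hgood (by rw [ha0]; exact dvd_zero _) hK hpv hvbar hne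
                  exact Literature.NumberTheory.EllipticCurves.InertiaFixedPoint.primary_eq_zero_of_forall_pairKer_inf_inertia_smul_eq
                    (W.baseChange K) κ₁ κ₂ vbar hS.1 hS.2 hm) ha⟩ = 0) →
      Module.IsTorsion (Literature.NumberTheory.EllipticCurves.IwasawaAlgebra₂ p) ((W.baseChange K).XGr₂ p κ₁ κ₂ vbar γ₁ γ₂) := by
  intro W _ _ p _ hp hgood ha0 hs K _ _ ι v vbar κ₁ κ₂ γ₁ γ₂ _ _ N _ f _ _ hK _ hpv hvbar hne _ _ _ _ _ hκ₁ _ hac hQ₁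
  haveI hγ₂ : Fact (κ₂.IsTopGenerator γ₂) :=
    ⟨Literature.NumberTheory.EllipticCurves.YanZhu2026.isTopGenerator_of_pair (κ₁ := κ₁) (γ₁ := γ₁)⟩
  have hp2 : p ≠ 2 := by omega
  have htor := torsionBy_eq_bot_of_isImaginaryQuadratic W K hK (Fact.out) hp2 hs
  have hKp : ∀ P : (W.baseChange K).toAffine.Point, p • P = 0 → P = 0 := fun P hP => by
    have hmem : P ∈ AddSubgroup.torsionBy (W.baseChange K).toAffine.Point (p : ℤ) :=
      AddSubgroup.torsionBy.nsmul_iff.mpr hP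
    rw [htor] at hmem
    exact AddSubgroup.mem_bot.mp hmem
  haveI hE : (W.baseChange K).IsElliptic := by rw [WeierstrassCurve.baseChange]; infer_instance
  have hS := Literature.NumberTheory.EllipticCurves.InertiaFixedPoint.isCyclic_and_card_inertia_map_baseChange
    (K := K) W hp2 hgood (by rw [ha0]; exact dvd_zero _) hK hpv hvbar hne
  exact xGr₂_isTorsion_of_isTorsion_XAc_of_serre_of_away (W.baseChange K) p κ₁ κ₂ vbar γ₁ γ₂ hκ₁
    hvbar hKp hS hac hQ₁

end Summit.BirchSwinnertonDyer.BirchSwinnertonDyer.Theorems.SignedBaseChangeAcDivControlTorsion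

end
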